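import Summits.BirchSwinnertonDyer.BirchSwinnertonDyer.Theses.PrintX11a
import Summits.BirchSwinnertonDyer.BirchSwinnertonDyer.Theorems.PrintX11aUpperNonSurjFiveExcFlatCores
import Literature.NumberTheory.EllipticCurves.HeckeCongruenceModulus
import HarnessLib

/-!
# Line «oldprod5» for crux U5 = `PrintX11a.UpperNonSurjFive` (item `stmt-BirchSwinnertonDyer-20614`)

bsd-idea-6 g13 (rev 2: g14, critic V#138 prices P1–P3 paid — text + one typed support statement; the six stubs and all proofs are
byte-identical), lens «decomp», CRUX-LEVEL ONLY (D-0152 / W-71; W-79 publish-only: this file is PUBLISHED with `ledger crux write`, never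
`skeleton check`ed — the line of record is «gl1cartan5» rev 11).

## Idea (one paragraph)

TAMAGAWA DEPTH IS ADDITIVE OVER THE CARRIERS BECAUSE THE WINDING ELEMENT LIES IN THE *PRODUCT* OF THE ℓ-OLD IDEALS.
For `E/ℚ` in class X11a at a non-surjective `p ≥ 5`, every split multiplicative prime `ℓ` of `E` is a CARRIER
(`E[p]` unramified at `ℓ`, `p ∣ c_ℓ = v_ℓ(Δ_min)`), and BSD asks `ord_p (L(E,1)/Ω_E) ≥ Σ_ℓ v_p(c_ℓ)` (`Ш[p] = 0`).
Every congruence road in the tree pays ONE `p` per carrier and per level-lowering (the record's C_tam / C_exc♭ are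
exactly «depth ≥ 2»).  The new object is the **ℓ-old ideal** `I_ℓ ⊆ 𝕋_N` of the anemic Hecke ring (annihilator of the
`ℓ`-old subspace, `oldIdealAt`) and Pasten's **congruence modulus** `η_f(I) = #(𝕋/(𝕀_f + I)) = [ℤ : χ_f(I)]` (tree:
`heckeCongruenceModulus`).  Two typed statements replace «one `p` per lowering»:
* (W) VALUE ∈ OLD PRODUCT: `ord_p (L(E,1)/Ω_E) ≥ Σ_{ℓ ∈ C} v_p η_f(I_ℓ)` for every set `C` of split multiplicative primes —
  the valuation shadow of «the `f`-component of the winding element lies in `χ_f(∏_{ℓ∈C} I_ℓ)`» (`χ_f(IJ) = χ_f(I)χ_f(J)`).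
  ONE prime, depth one = the lead's g6 EXC road ∕ Greenberg–Vatsal (Ribet's congruence module `T^{old}/(α_ℓ²−1)` +
  the winding identity `e^{old,α} = (1 − β_ℓ/ℓ)·e_M = unit·(α_ℓ² − 1)·e_M` + canonical periods); SEVERAL primes = the
  research content: principality `I_ℓ·T^{ℓ-new}_𝔪 = (ξ_ℓ)` (multiplicity one of the character group `X_ℓ(J₀(N))_𝔪`
  + Gorenstein, `Φ_ℓ = T^{ℓ-new}/ξ_ℓ`) and its coherence one level down (Ribet 1990 §4 exact sequences).
* (D) LOWERING DEPTH = TAMAGAWA DEPTH: `v_p η_f(I_ℓ) ≥ v_p(c_ℓ)`, i.e. `f` is congruent modulo `p^{v_p(c_ℓ)}` to the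
  `ℓ`-old Hecke algebra (a WEAK eigenform of level `N/ℓ` mod `p^k`, Dahmen–Yazdani ∕ Chen–Kiming–Wiese language):
  for `ℓ ≢ 1 (mod p)` this is MAZUR'S PRINCIPLE applied to `E[p^k] ⊂ J₀(N)` (unramified at `ℓ` ⟺ `p^k ∣ c_ℓ`), for
  `ℓ = p` at depth one it is the tree's `ribet1990_levelLowering_gamma0_newform_general_of_five_le`; the carriers
  `ℓ ≡ 1 (mod p)` (where Mazur's principle fails and Ribet's `(p,q)`-switch has no mod-`p^k` version) are ISOLATED as
  their own stub (D♯).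
LITERATURE NAME OF THE HECKE SIDE (found by presearch, corpus): (D) summed over the carriers is the «≥» half of the
POLLACK–WESTON QUANTITATIVE LEVEL-LOWERING CONJECTURE `ord η_f(aq,b) = t_f(q) + ord η_f(a,qb)` (`t_f(q)` = Tamagawa
exponent `= v_p(c_q)` for elliptic curves), descended from the RIBET–TAKAHASHI formula `ord_p δ_{Q̄} = ord_p δ_Q + c_{q₁} + c_{q₂}`
for Shimura-curve degrees; in print it is stated and proved ONLY for `(N,p) = 1` (PW 2011: image ⊇ SL₂(𝔽_p) and carriers
`q ≢ ±1 (mod p)`; Kim–Ota 2019 Thm. 1.3: `p ∤ N`, `2 ≤ k ≤ p−1`, via `R = 𝕋` + adjoint `L`-values; Böckle–Khare–Manning: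
`p ∤ NQ`; Fakhruddin–Khare–Ramakrishna: surjective `ρ̄`).  On X11a `p ∥ N` ALWAYS (`Mult W p`) and the image never contains
`SL₂(𝔽_p)` (`¬ Surj`), so NO printed quantitative-level-lowering theorem applies: (D♭) at depth ≥ 2 is print-ADJACENT
(Mazur's principle mod `p^k` at `p ∥ N`, small image), (D♯) is open even at `p ∤ N` (PW's excluded `q ≡ ±1`, BKM's
«trivial primes»), and BOTH are print-composite at depth one (Ribet 1990 Thm. 1.1 ∕ the tree's `hLL`).  The VALUE side (W) —
additivity for `L(E,1)/Ω_E` itself rather than for congruence numbers — has no printed counterpart beyond one prime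
(Greenberg–Vatsal); its several-prime proof plan runs through the same character-group exact sequences as Ribet–Takahashi.
Then (W)+(D)+(T: `v_p ∏c = Σ_{split ℓ} v_p v_ℓ(Δ)`, Kodaira–Néron) give `ord_p(L/Ω) ≥ v_p ∏c`, which with `Ш[p] = 0`
is `MissingUpperBoundAt` (the lead's door).  This CLOSES the record's C_tam (non-split `p`, depth ≥ 2 — class-wide)
and the Tamagawa part of C_exc♭ (split `p` with `v_p(c_p) = 1`), modulo (W), (D♭), (D♯), (T) and the prints; the
RESIDUAL is «`Ш[p] ≠ 0`» (the record's C_exp and the `Ш`-part of C_exc♭) ∪ «split `p` with `p² ∣ c_p`» (census-empty).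

CENSUS-VISIBLE CONTENT (critic V#138 P3, stated up top): at BOTH depth-2 census pairs EVERY carrier has depth ONE (`118080ds1`:
`c₅ = c₄₁ = 5`; `346560lh1`: `c₃ = 5`, `v₅(c₅ = 10) = 1`), and among all 56 known non-surjective X11a pairs at `p = 5` (`N < 5·10⁵`, tree
records `RecordsLeafNonSurjN500000Part1/2`) and the 5 known pairs at `p = 7` NO multiplicative prime has `p² ∣ v_ℓ(Δ_min)`: so on the census
the line's ENTIRE content is (W) at `|C| = 2` (two depth-one carriers ⟹ `p²`), with (D♭)/(D♯) used at depth one only (print: Ribet 1990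
Thm. 1.1); single-carrier depth ≥ 2 is class-wide content without a census instance.  The «automatic» converse bound
`v_p η_f(I_ℓ) ≤ v_p(c_ℓ)` that makes (W) BSD-consistent is TYPED below as the support statement `AutomaticDepthBound` (V#138 P2; not a stub,
not load-bearing).

BSD is not proved by any of this.  U5 is not closed by this file: six `sorry`s, all inside `stub_*`.

References: [PollackWeston2011] Conj. 1.1 / Thm. 1.2 (Compos. Math. 147, 1353–1381; as quoted in arXiv:1905.02926 p. 3);
[KimOta2019] Thm. 1.3, Def. 1.15 (arXiv:1905.02926 pp. 3, 6; Res. Math. Sci. 10); [RibetTakahashi1997] Thm. 1 (PNAS 94) and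
[Takahashi2001] (as quoted in arXiv:2408.15410 p. 3 and Bertolini–Darmon 1999 Duke Thm. 6.7); [BoeckleKhareManning2021]
Thm. 1.1 (arXiv:2108.09729 p. 3); [FakhruddinKhareRamakrishna2021] Thm. 1 (arXiv:1910.07319 p. 3);
[Ribet1990] §§2–4 (Invent. Math. 100), Thm. 1.1; [DahmenYazdani2012] Thm. 2 (arXiv:1009.0284 p. 4);
[ChenKimingWiese2013] (arXiv:1105.1918) weak/strong/dc-weak eigenforms mod `p^m`; [DieulefaitTaixes2009] (level lowering
mod `ℓ^n`); [PastenShimura2024] §§4.8–5.4 (the congruence modulus `η`); [GreenbergVatsal2000] §3 (17)–(19), Prop. 3.7;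
[Vatsal1999] Thm. 1.13; [BertoliniDarmon2005] §5 (multiplicity one for character groups); [DarmonDiamondTaylor1995]
Thm. 3.15, §4.4; [Wiles1995] Thm. 2.1; [SilvermanATAEC1994] Cor. IV.9.2 (d), Table 4.1; [Miller2011LMS] Def. 1.1.
-/

set_option linter.dupNamespace false
set_option autoImplicit false

noncomputable section

open scoped Classical NumberField MatrixGroups ModularForm

open CongruenceSubgroup WeierstrassCurve
  Literature.NumberTheory.EllipticCurves
  Literature.NumberTheory.EllipticCurves.ModularForms
  Literature.NumberTheory.EllipticCurves.Rank1Residual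
  Literature.NumberTheory.EllipticCurves.Rank1Residual.Typed
  Literature.NumberTheory.EllipticCurves.Wuthrich2014
  Summit.BirchSwinnertonDyer.Rank1Residual
  Summit.BirchSwinnertonDyer.BirchSwinnertonDyer.Theorems.GL1Cartan

namespace Summit.BirchSwinnertonDyer.BirchSwinnertonDyer.Cruxes.UpperNonSurjFive.OldProd

/-! ## §1 The new objects: the `ℓ`-old subspace, the `ℓ`-old ideal, the `ℓ`-lowering congruence modulus -/

section Objects

variable (N : ℕ) [NeZero N]

/-- **The `ℓ`-old subspace of `S₂(Γ₀(N))`**: the span of the images of `S₂(Γ₀(N/ℓ))` under the two degeneracy maps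
`z ↦ z`, `z ↦ ℓz` (the degeneracy indices `(M, d)` of the tree's `oldSubspace0` with `M·ℓ = N`, hence `d ∈ {1, ℓ}` for `ℓ`
prime); `⊥` when `ℓ ∤ N`. [cite: AtkinLehner1970, §2] [cite: Ribet1990, §3 (the ℓ-old subvariety of J₀(N))] -/
def oldSubspaceAt (ℓ : ℕ) : Submodule ℂ (CuspForm (Gamma0 N) 2) :=
  ⨆ Md : {Md : DegeneracyIndex N // Md.1.1 * ℓ = N},
    LinearMap.range (degeneracyMap0 Md.1.1.1 N Md.1.1.2 2)

/-- **The `ℓ`-old ideal `I_ℓ ⊆ 𝕋_N`** of the anemic Hecke ring `𝕋_N = ℤ[T_n : (n,N)=1]` (tree `anemicHeckeRing N 2`): the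
annihilator of the `ℓ`-old subspace.  `𝕋_N/I_ℓ` is the `ℓ`-old quotient `𝕋^{ℓ-old}`; for a newform `f`, `χ_f(I_ℓ) ⊆ ℤ`
measures the congruences between `f` and the `ℓ`-old Hecke algebra (Ribet's congruence module between the `ℓ`-new and
`ℓ`-old parts, seen from `f`). [cite: Ribet1990, §3 and Thm. 3.11 (congruence module = component group)] [cite: PastenShimura2024, §4.11 p. 16] -/
def oldIdealAt (ℓ : ℕ) : Ideal (anemicHeckeRing N 2) where
  carrier := {t | ∀ g ∈ oldSubspaceAt N ℓ, (t : Module.End ℂ (CuspForm (Gamma0 N) 2)) g = 0}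
  zero_mem' := by
    intro g _
    simp
  add_mem' {s t} hs ht := by
    intro g hg
    simp only [Set.mem_setOf_eq] at hs ht
    rw [Subalgebra.coe_add, LinearMap.add_apply, hs g hg, ht g hg, add_zero]
  smul_mem' c {t} ht := by
    intro g hg
    simp only [Set.mem_setOf_eq] at ht
    rw [smul_eq_mul, Subalgebra.coe_mul, Module.End.mul_apply, ht g hg, map_zero]

/-- **The `ℓ`-lowering congruence modulus `η_f(I_ℓ) = #(𝕋_N/(𝕀_f + I_ℓ))`** (Pasten's `η`, tree `heckeCongruenceModulus`):
for `f` with integral eigenvalues `= [ℤ : χ_f(I_ℓ)]` (`heckeCongruenceModulus_eq_absNorm`); `p^k ∣ η_f(I_ℓ)` iff `χ_f mod p^k`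
factors through `𝕋^{ℓ-old}`, i.e. `f` is congruent mod `p^k` to a WEAK eigenform of the `ℓ`-old space (Chen–Kiming–Wiese).
`0` iff the quotient is infinite (never, for `f` new: informational). [cite: PastenShimura2024, §5.4 p. 17] -/
abbrev oldCongruenceModulus (f : CuspForm (Gamma0 N) 2) (ℓ : ℕ) : ℕ :=
  heckeCongruenceModulus f (oldIdealAt N ℓ)

end Objects

/-- **The set of split multiplicative primes of `E`** (as a `Finset` of the prime factors of the conductor). On X11a at a
non-surjective `p ≥ 5` every such `ℓ` is a CARRIER (`E[p]` unramified at `ℓ`, `p ∣ c_ℓ`; the tree's `¬ Ram`). [cite: SilvermanATAEC1994, Thm. IV.10.2] -/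
def splitPrimes (W : WeierstrassCurve ℚ) [W.IsElliptic] : Finset ℕ :=
  (W.conductorNorm ℤ).primeFactors.filter (fun ℓ => ∃ _ : Fact ℓ.Prime, W.HasSplitMultiplicativeReductionAtPrime ℓ)

/-- **The PRINT-LOWERABLE depth at `ℓ`**: `v_p(v_ℓ(Δ_min)) = v_p(c_ℓ)` at a split `ℓ ≠ p` (Tate: `E[p^k]` is unramified at
`ℓ` iff `p^k ∣ v_ℓ(q_E) = c_ℓ`), capped at `1` for `ℓ = p` (finite-flat level lowering is in print only mod `p`:
Darmon–Diamond–Taylor Thm. 3.15). [cite: SilvermanATAEC1994, Cor. IV.9.2 (d)] [cite: DarmonDiamondTaylor1995, Thm. 3.15] -/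
def lowerableDepth (W : WeierstrassCurve ℚ) [W.IsGloballyMinimal] (p ℓ : ℕ) : ℕ :=
  if ℓ = p then min 1 (padicValNat p (padicValInt ℓ W.minimalDiscriminantInt))
  else padicValNat p (padicValInt ℓ W.minimalDiscriminantInt)

/-! ## §2 The statements of the line -/

/-- **S1 — the thirteen named print facts of the record's turnkey `GL1Cartan.upperNonSurjFive_of_elevenFacts_of_threeFlatCores`,
as ONE conjunction BY NAME** (Stein–Wuthrich 6.1 ×2, Kato 12.4, modularity, Kato §17.13 ×3, Mazur 1978 Cor. 4.1, GZK,
Coleman–Edixhoven 1998 Thm. 2.1, Greenberg–Vatsal 2000 §3, Ribet 1984 Thm. 4.1, Darmon–Diamond–Taylor Thm. 3.15 at `p ≥ 5`).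
[cite: Kato2004Asterisque, Thm. 12.4 and §17.13] [cite: SteinWuthrich2013, Thm. 6.1] [cite: DarmonDiamondTaylor1995, Thm. 3.15] -/
def PrintFacts : Prop :=
  Literature.NumberTheory.EllipticCurves.SteinWuthrich2013.thm61_splitMultiplicative ∧
    Literature.NumberTheory.EllipticCurves.SteinWuthrich2013.thm61_nonsplitMultiplicative ∧
    Literature.NumberTheory.EllipticCurves.Kato2004.thm12_4 ∧
    Literature.NumberTheory.EllipticCurves.ModularForms.exists_isNewformOf ∧
    Literature.NumberTheory.EllipticCurves.Kato2004.exists_multDivisibilityInputs_nonsplit_contra ∧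
    Literature.NumberTheory.EllipticCurves.Kato2004.exists_multDivisibilityInputs_split_contra ∧
    Literature.NumberTheory.EllipticCurves.Kato2004.exists_multDivisibilityInputs_fine_contra ∧
    Literature.NumberTheory.EllipticCurves.ModularForms.mazur_not_dvd_maninConstant_of_odd ∧
    rank_eq_analyticRank_of_analyticRank_le_one ∧
    colemanEdixhoven1998_heckePolynomial_simpleRoots ∧ greenbergVatsal2000_plusSymbol_congruence ∧
    ribet1984_iharaLemma ∧ ribet1990_levelLowering_gamma0_newform_general_of_five_le

/-- **S2 — (W) VALUE ∈ OLD PRODUCT (THE KEY; research).**  For minimal `E/ℚ` in class X11a with `ρ̄_{E,p}` not surjective,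
`p ≥ 5`, `f = f_E ∈ S₂(Γ₀(N_E))` its newform, ANY finite set `C` of split multiplicative primes of `E`, and
`L(E,1)/Ω_E = t ∈ ℚ`:  `Σ_{ℓ ∈ C} v_p η_f(I_ℓ) ≤ ord_p t`.  MECHANISM: the plus winding element `e_N ∈ H₁(X₀(N),ℤ_p)⁺_𝔪 ≅ T_𝔪`
(multiplicity one at the non-Eisenstein `𝔪 = (p, 𝕀_f)`, Gorenstein) is `t_e·s₀` with `λ_g(t_e) = L(g,1)/Ω_g^{can}`; for ONE `ℓ`:
`T_𝔪 = T^{new} ×_{T^{old}/(α_ℓ²−1)} T^{old}` (Ribet), the old component of `t_e` is `(1 − β_ℓ/ℓ)·t_{e,N/ℓ} = u(α_ℓ²−1)t_{e,N/ℓ}`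
(`L(g^{(α)},1) = (1 − β/ℓ)L(g,1)`, `ℓ − β = β(α − 1)`, split sign), hence `t_e ≡ j (mod I^{ℓ-new})` with `j ∈ I_ℓ` and
`λ_f(t_e) = λ_f(j) ∈ χ_f(I_ℓ)`, i.e. `ord_p(L(E,1)/Ω^{can}) ≥ v_p η_f(I_ℓ)`, and `Ω^{can} ∼ Ω_E` up to a `p`-unit (GV Rem. 3.4,
Mazur Cor. 4.1) — at depth `v_p η = 1` this is the lead's g6 EXC road; for SEVERAL `ℓ`: `χ_f(∏ I_ℓ) = ∏ χ_f(I_ℓ)`, and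
«`t_e`'s `f`-value lies in `χ_f(I_{ℓ₁} I_{ℓ₂})`» follows from PRINCIPALITY `I_{ℓ₂}T^{ℓ₂-new}_𝔪 = (ξ₂)` (`X_{ℓ₂}(J₀(N))_𝔪` free of
rank one over `T^{ℓ₂-new}_𝔪`, Gorenstein ⟹ monodromy pairing `= ·ξ₂`, `Φ_{ℓ₂,𝔪} ≅ T^{ℓ₂-new}/ξ₂ ≅ T^{ℓ₂-new}/I_{ℓ₂}T^{ℓ₂-new}`
(Ribet: component group = congruence module) ⟹ equal annihilators) + COHERENCE (`ξ₂` maps to a generator of the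
level-`N/ℓ₁` ideal: Ribet 1990 §4, `X_{ℓ₁}(J^{ℓ₁ℓ₂-Sh}) ≅ ker(X_{ℓ₂}(J₀(N)) → X_{ℓ₂}(J₀(N/ℓ₁))²)` — the exact sequences
behind the Ribet–Takahashi formula `ord_p δ_{Q̄} = ord_p δ_Q + c_{q₁} + c_{q₂}`) + the one-prime argument INSIDE the `ℓ₂`-new
algebra (Ihara for the definite quaternion algebra ramified at `ℓ₂`: Diamond–Taylor).  In print the CONGRUENCE-NUMBER
shadow of this additivity is the Pollack–Weston conjecture ∕ Kim–Ota theorem (`(N,p) = 1` only); the `L`-VALUE version is not.  WHY IT MIGHT FAIL: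
(i) at `ℓ ≡ ±1 (mod p)` (`α_ℓ ≡ β_ℓ`) `T^{ℓ-old}_𝔪` is not étale over `T_{N/ℓ}` and the congruence module is not `(α²−1)`;
(ii) coherence: if `Φ_{ℓ₂}` GROWS under `ℓ₁`-raising at `𝔪` by the `ℓ₁`-congruence factor, the chase yields only
`max(κ₁,κ₂)`; (iii) multiplicity one for `X_ℓ(J₀(N))_𝔪` with `p ∥ N` (here `p` is always multiplicative) needs the
`p`-ordinary-distinguished form (Wiles Thm. 2.1).  BSD-CONSISTENT for every `C`: `v_p η_f(I_ℓ) ≤ v_p(c_ℓ)` always — the typed support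
statement `AutomaticDepthBound` below (a weak congruence mod `p^k` with the `ℓ`-old algebra makes `E[p^k]` unramified ∕ finite flat at `ℓ`;
Carayol + Tate), so (W) never claims more than BSD's `ord_p(L/Ω) ≥ v_p ∏c` (with (T)).
[cite: Ribet1990, Thm. 3.11, §4 (4.2)–(4.4)] [cite: GreenbergVatsal2000, §3 (17)–(19), Prop. 3.7, Rem. 3.4] [cite: Vatsal1999, Thm. 1.13]
[cite: BertoliniDarmon2005, §5.2 (multiplicity one for X_ℓ)] [cite: Wiles1995, Thm. 2.1] [cite: Mazur1978, Cor. 4.1]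
[cite: RibetTakahashi1997, Thm. 1 (as quoted in arXiv:2408.15410 p. 3)] [cite: KimOta2019, Conj. 1.1 and Thm. 1.3 (arXiv:1905.02926 p. 3)] -/
def ValueInOldProduct : Prop :=
  ∀ (W : WeierstrassCurve ℚ) [W.IsElliptic] [W.IsGloballyMinimal] [NeZero (W.conductorNorm ℤ)] (p : ℕ) [Fact p.Prime],
    ClassX11a W p → ¬ Surj W p → 5 ≤ p →
    ∀ (f : CuspForm (Gamma0 (W.conductorNorm ℤ)) 2), IsNewformOf W f →
    ∀ (C : Finset ℕ), (∀ ℓ ∈ C, ∃ _ : Fact ℓ.Prime, W.HasSplitMultiplicativeReductionAtPrime ℓ) →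
    ∀ t : ℚ, W.entireLFunction 1 / (W.realPeriodRat : ℂ) = (t : ℂ) →
      ((∑ ℓ ∈ C, padicValNat p (oldCongruenceModulus (W.conductorNorm ℤ) f ℓ) : ℕ) : ℤ) ≤ padicValRat p t

/-- **S3 — (D♭) MAZUR-PRINCIPLE DEPTH (depth one print-composite, depth ≥ 2 print-ADJACENT; the «≥» half of the Pollack–Weston
quantitative level-lowering conjecture at a carrier `ℓ ≢ 1 (mod p)`, in the anemic old-ideal currency, at `p ∥ N`).**  For `E`, `p`,
`f` as in S2 and a split multiplicative prime `ℓ` of `E` with `ℓ ≢ 1 (mod p)`: `lowerableDepth ≤ v_p η_f(I_ℓ)`, i.e. for `ℓ ≠ p`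
`f` is congruent modulo `p^{v_p(c_ℓ)}` to the `ℓ`-old Hecke algebra, and for `ℓ = p` modulo `p`.  PROOF SKETCH: `E[p]`
irreducible ⟹ no `p`-isogeny in the class ⟹ `E[p^k] ≅ E⁎[p^k] ⊂ J₀(N)` for the optimal `E⁎`, a `𝕋`-stable finite subgroup
on which `𝕋` acts through `χ_f`; for `ℓ ≠ p`, `p^k ∣ c_ℓ = v_ℓ(q_E)` ⟺ `E[p^k]` unramified at `ℓ`, and MAZUR'S PRINCIPLE
(`ℓ ≢ 1 mod p`: an unramified `𝕋`-stable `V ⊂ J₀(N)[p^∞]` meets the `ℓ`-toric part trivially since `Frob_ℓ` acts there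
with eigenvalue ratio `ℓ ≢ 1`, so `𝕋` acts on `V` through `𝕋^{ℓ-old}`) gives `χ_f(I_ℓ) ≡ 0 (mod p^k)`, whence `p^k ∣ η_f(I_ℓ)`
(`dvd_heckeCongruenceModulus_of_forall_dvd`); for `ℓ = p` (finite at `p` since `p ∣ v_p(Δ)` at `¬ Surj`) the tree's
`ribet1990_levelLowering_gamma0_newform_general_of_five_le` gives a congruent eigenform in the `p`-old space, and an
anemic `t ∈ I_p` kills it, so `χ_f(t) ≡ 0 (mod 𝔭)`.  In print mod `p^k` only for `(N,p) = 1`: Pollack–Weston 2011 Thm. 1.2 (image ⊇ SL₂(𝔽_p), carriers `≢ ±1`),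
Kim–Ota 2019 Thm. 1.3 (`p ∤ N`, `R = 𝕋`), Dahmen–Yazdani Thm. 2 (`T_∅ = ℤ_p`); the mod-`p^k` Mazur principle at `p ∥ N` with
image a Cartan normaliser ∕ exceptional is the transcription risk (M).  WHY IT MIGHT FAIL: `η_f(I_ℓ)` is ANEMIC (no `U_ℓ`); at
`ℓ ≢ ±1 (mod p)` anemic depth = full depth (`(α−1)(α−ℓ) ≡ 0`, `α ≢ ℓ`); at `ℓ ≡ −1` the two `U_ℓ`-signs may mix (PW exclude `±1`).
[cite: Ribet1990, Thm. 1.1 and §3 (Mazur's principle)] [cite: KimOta2019, Thm. 1.2–1.3 (arXiv:1905.02926 p. 3)]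
[cite: DahmenYazdani2012, Thm. 2 (arXiv:1009.0284 p. 4)]
[cite: DarmonDiamondTaylor1995, Thm. 3.15] [cite: PastenShimura2024, Prop. 5.4] -/
def MazurPrincipleDepth : Prop :=
  ∀ (W : WeierstrassCurve ℚ) [W.IsElliptic] [W.IsGloballyMinimal] [NeZero (W.conductorNorm ℤ)] (p : ℕ) [Fact p.Prime],
    ClassX11a W p → ¬ Surj W p → 5 ≤ p →
    ∀ (f : CuspForm (Gamma0 (W.conductorNorm ℤ)) 2), IsNewformOf W f →
    ∀ (ℓ : ℕ) [Fact ℓ.Prime], W.HasSplitMultiplicativeReductionAtPrime ℓ → ℓ % p ≠ 1 →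
      lowerableDepth W p ℓ ≤ padicValNat p (oldCongruenceModulus (W.conductorNorm ℤ) f ℓ)

/-- **S4 — (D♯) THE `ℓ ≡ 1 (mod p)` CARRIERS (research-S; the typed obstruction — Pollack–Weston's excluded case,
Böckle–Khare–Manning's «trivial primes», open in print even for `p ∤ N` at depth ≥ 2; depth one = Ribet 1990 Thm. 1.1).**  Same as S3 at a split carrier
`ℓ ≡ 1 (mod p)` (so `ℓ ≠ p`): `v_p(v_ℓ Δ_min) ≤ v_p η_f(I_ℓ)`.  Here Mazur's principle FAILS (`Frob_ℓ`-eigenvalue ratio `ℓ ≡ 1`),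
Ribet's mod-`p` proof goes through the `(p,q)`-switch on a Shimura curve, which has no mod-`p^k` (weak-eigenform) version in
print; `R^{unip}_Σ = 𝕋_Σ(Γ₀)` integrally would give it (the local deformation ring at `ℓ ≡ 1 (mod p)` is the bad one: Shotton).
Census relevance: `118080ds1` at `p = 5` has carriers `{5, 41}`, `41 ≡ 1 (mod 5)`.  WHY IT MIGHT FAIL: it should not be
false (BSD-consistent, `≤ v_p(c_ℓ)` automatic) — the risk is that it is as hard as integral `R = 𝕋` at a vexing-type prime.
[cite: Ribet1990, Thm. 1.1 (the case ℓ ≡ 1 mod p)] [cite: BoeckleKhareManning2021, Thm. 1.1 and §5.2 (arXiv:2108.09729 pp. 3, 23)]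
[cite: DahmenYazdani2012, Thm. 2 and Rem. 3] -/
def CongruentOneDepth : Prop :=
  ∀ (W : WeierstrassCurve ℚ) [W.IsElliptic] [W.IsGloballyMinimal] [NeZero (W.conductorNorm ℤ)] (p : ℕ) [Fact p.Prime],
    ClassX11a W p → ¬ Surj W p → 5 ≤ p →
    ∀ (f : CuspForm (Gamma0 (W.conductorNorm ℤ)) 2), IsNewformOf W f →
    ∀ (ℓ : ℕ) [Fact ℓ.Prime], W.HasSplitMultiplicativeReductionAtPrime ℓ → ℓ % p = 1 →
      padicValNat p (padicValInt ℓ W.minimalDiscriminantInt) ≤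
        padicValNat p (oldCongruenceModulus (W.conductorNorm ℤ) f ℓ)

/-- **S4♮ — THE AUTOMATIC DEPTH BOUND `v_p η_f(I_ℓ) ≤ v_p(c_ℓ)` (SUPPORT statement, typed at the critic's request V#138 P2; NOT a
stub and NOT load-bearing for the composition — it is what makes (W) BSD-consistent: with (T), (W) + (S4♮) assert at most
`ord_p(L(E,1)/Ω_E) ≥ v_p ∏c`, which BSD gives at `Ш`-free level and never contradicts).**  For `E`, `p`, `f` as in S2 and ANY split
multiplicative prime `ℓ` of `E` (the case `ℓ = p` included): `v_p η_f(I_ℓ) ≤ v_p(v_ℓ Δ_min)` (`= v_p(c_ℓ)`, Tate).  PROOF PLAN (print-composite,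
M): `p^k ∣ η_f(I_ℓ)` ⟹ `χ_f(I_ℓ) ⊆ p^k ℤ` ⟹ `χ_f mod p^k` factors through the localised `ℓ`-old algebra `𝕋^{ℓ-old}_{𝔪'}` (`𝔪'` under
`(p, 𝕀_f)`); `𝕋^{ℓ-old}_{𝔪'}` carries `ρ^{old} : G_ℚ → GL₂(𝕋^{ℓ-old}_{𝔪'})` with `tr ρ^{old}(Frob_r) = T_r` (the product of the `ρ_g`, `g` new of
level dividing `N/ℓ`, DESCENDED to the trace ring by CARAYOL's theorem — `ρ̄ = E[p]` is absolutely irreducible, `p` odd), UNRAMIFIED at `ℓ` when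
`ℓ ≠ p` (`ℓ ∥ N`, so `ℓ ∤ N/ℓ`) and FINITE FLAT at `p` when `ℓ = p` (`J₀(N/p)` has good reduction at `p`; sub-quotients stay finite flat by
Raynaud, `e = 1 < p − 1`); Carayol again (Chebotarev + traces): `E[p^k] ≅ ρ^{old} ⊗ ℤ/p^k`; TATE CURVE: `E[p^k]` is unramified at a split
`ℓ ≠ p` (resp. finite flat at `ℓ = p`) iff `p^k ∣ v_ℓ(q_E) = v_ℓ(Δ_min)`.  Junk value: `η = 0` (never for `f` new) gives `0 ≤ ·`, true.
Provers may land it `--supports` the crux; nothing in §4 uses it.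
[cite: DarmonDiamondTaylor1995, §2 (Carayol's theorem: representations over local rings determined by traces)] [cite: Ribet1990, §3]
[cite: SilvermanATAEC1994, Cor. IV.9.2 (d) and §V.5 (the Tate curve's p^k-torsion)] -/
def AutomaticDepthBound : Prop :=
  ∀ (W : WeierstrassCurve ℚ) [W.IsElliptic] [W.IsGloballyMinimal] [NeZero (W.conductorNorm ℤ)] (p : ℕ) [Fact p.Prime],
    ClassX11a W p → ¬ Surj W p → 5 ≤ p →
    ∀ (f : CuspForm (Gamma0 (W.conductorNorm ℤ)) 2), IsNewformOf W f →
    ∀ (ℓ : ℕ) [Fact ℓ.Prime], W.HasSplitMultiplicativeReductionAtPrime ℓ →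
      padicValNat p (oldCongruenceModulus (W.conductorNorm ℤ) f ℓ) ≤
        padicValNat p (padicValInt ℓ W.minimalDiscriminantInt)

/-- **S5 — (T) TAMAGAWA VALUATION SPLITS OVER THE SPLIT PRIMES (support, S: Kodaira–Néron + Tate).**  For minimal elliptic
`W/ℚ` and a prime `p ≥ 5`: `v_p ∏_ℓ c_ℓ = Σ_{ℓ ∣ N split mult} v_p(v_ℓ Δ_min)` — `c_ℓ = v_ℓ(Δ_min)` at split `ℓ`, `c_ℓ ∈ {1,2}` at
non-split, `c_ℓ ≤ 4` at additive `ℓ` (in tree: `tamagawaProduct_eq_prod`, `padicValNat_localTamagawaNumber_eq_zero`,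
`X11b.dvd_tamagawaProduct_iff_exists_split`).  Bookkeeping, stated as a stub only to keep this workfile short.
[cite: SilvermanATAEC1994, Cor. IV.9.2 (d) and Table 4.1] -/
def TamagawaValuationSplits : Prop :=
  ∀ (W : WeierstrassCurve ℚ) [W.IsElliptic] [W.IsGloballyMinimal] (p : ℕ) [Fact p.Prime], 5 ≤ p →
    padicValNat p W.tamagawaProduct =
      ∑ ℓ ∈ splitPrimes W, padicValNat p (padicValInt ℓ W.minimalDiscriminantInt)

/-- **S6 — (R) THE RESIDUAL of the line (open; U5 restricted, typed and measured).**  What additivity does NOT touch: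
(a) the record's C_exp VERBATIM (non-split `p`, `Ш(E)[p] ≠ 0`, hard value) and (b) split `p` with `Ш(E)[p] ≠ 0` OR with
`p² ∣ v_p(Δ_min) = c_p` (Tamagawa depth ≥ 2 AT `p`: finite-flat lowering mod `p²`, census-empty at `N < 5·10⁵`).  (a) ∪ (b)«Ш»
is the exponent-of-`Ш` problem at small image (wall `EulerSystemBigImageAtSmallImage`); (b)«`p² ∣ c_p`» would dissolve under
the Hecke-side strengthening «`v_p(v_p Δ) ≤ v_p η_f(I_p)`» (finite-flat Mazur mod `p^k`), not typed here.
[cite: Miller2011LMS, Def. 1.1] [cite: Kato2004Asterisque, §17.13] -/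
def Residual : Prop :=
  (∀ (W : WeierstrassCurve ℚ) [W.IsElliptic] [W.IsGloballyMinimal] (p : ℕ) [Fact p.Prime],
      ClassX11a W p → ¬ Surj W p → 5 ≤ p → ¬ W.HasSplitMultiplicativeReductionAtPrime p →
      (∃ x : W.sha, (p : ℤ) • x = 0 ∧ x ≠ 0) →
      (∀ t : ℚ, W.entireLFunction 1 / (W.realPeriodRat : ℂ) = (t : ℂ) → padicValRat p t ≠ 0) →
      MissingUpperBoundAt W p) ∧
  (∀ (W : WeierstrassCurve ℚ) [W.IsElliptic] [W.IsGloballyMinimal] (p : ℕ) [Fact p.Prime],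
      ClassX11a W p → ¬ Surj W p → 5 ≤ p → W.HasSplitMultiplicativeReductionAtPrime p →
      ((∃ x : W.sha, (p : ℤ) • x = 0 ∧ x ≠ 0) ∨ p ^ 2 ∣ padicValInt p W.minimalDiscriminantInt) →
      MissingUpperBoundAt W p)

/-! ## §3 The six registered stubs (the ONLY `sorry`s of the file) -/

/-- S1 (print, XS by name). [cite: Kato2004Asterisque, Thm. 12.4 and §17.13] -/
theorem stub_printFacts : PrintFacts := by
  sorry

/-- S2 (W) — THE KEY (research: one prime print-composite, several primes = principality + coherence). [cite: Ribet1990, Thm. 3.11 and §4] -/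
theorem stub_valueInOldProduct : ValueInOldProduct := by
  sorry

/-- S3 (D♭) — Mazur-principle depth at `ℓ ≢ 1 (mod p)` (print-composite, M). [cite: Ribet1990, Thm. 1.1] -/
theorem stub_mazurPrincipleDepth : MazurPrincipleDepth := by
  sorry

/-- S4 (D♯) — the `ℓ ≡ 1 (mod p)` carriers (research-S). [cite: DahmenYazdani2012, Thm. 2] -/
theorem stub_congruentOneDepth : CongruentOneDepth := by
  sorry

/-- S5 (T) — Tamagawa valuation = split-carrier sum (support, S). [cite: SilvermanATAEC1994, Cor. IV.9.2 (d)] -/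
theorem stub_tamagawaValuationSplits : TamagawaValuationSplits := by
  sorry

/-- S6 (R) — the residual (open). [cite: Miller2011LMS, Def. 1.1] -/
theorem stub_residual : Residual := by
  sorry

/-! ## §4 Real proofs: the depth engine and the composition BY NAME -/

/-- **THE ENGINE (real proof): (W) + (D♭) + (D♯) + (T) ⟹ `ord_p ∏c ≤ ord_p(L(E,1)/Ω_E)` ⟹ `MissingUpperBoundAt` on «`Ш[p] = 0` ∧
¬(split `p` ∧ `p² ∣ c_p`)»**, for every X11a pair with `¬ Surj`, `p ≥ 5` (any reduction type at `p`, any Tamagawa depth).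
Pointwise on `C` = the split primes: `v_p(v_ℓ Δ) ≤ v_p η_f(I_ℓ)` (D♭ ∕ D♯; at `ℓ = p` because `v_p(v_p Δ) ≤ 1`), sum, (W), (T),
then the lead's door `ClassX11a.missingUpperBoundAt_of_noPTorsion` with `ord_p #Ш_an = ord_p t − ord_p ∏c`
(`GL1Cartan.padicValRat_shaAn_eq_sub_tamagawa`). [cite: Miller2011LMS, Def. 1.1] [cite: SilvermanATAEC1994, Cor. IV.9.2 (d)] -/
theorem missingUpperBoundAt_of_depth
    (hnf : exists_isNewformOf) (hMz : mazur_not_dvd_maninConstant_of_odd)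
    (hGZK : rank_eq_analyticRank_of_analyticRank_le_one)
    (hW : ValueInOldProduct) (hD : MazurPrincipleDepth) (hD1 : CongruentOneDepth) (hT : TamagawaValuationSplits)
    {W : WeierstrassCurve ℚ} [W.IsElliptic] [W.IsGloballyMinimal] {p : ℕ} [Fact p.Prime]
    (hX : ClassX11a W p) (hns : ¬ Surj W p) (hp5 : 5 ≤ p)
    (hSha : ∀ x : W.sha, (p : ℤ) • x = 0 → x = 0)
    (hflat : W.HasSplitMultiplicativeReductionAtPrime p → ¬ p ^ 2 ∣ padicValInt p W.minimalDiscriminantInt) :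
    MissingUpperBoundAt W p := by
  haveI : NeZero (W.conductorNorm ℤ) := ⟨(W.conductorNorm_pos_holds).ne'⟩
  obtain ⟨t, ht, ht0, -⟩ := hX.exists_LOne_div_realPeriod_eq_of_mazur hnf hMz hp5
  have hL1 : W.entireLFunction 1 ≠ 0 := by
    intro h0
    apply ht0
    have h : ((t : ℚ) : ℂ) = 0 := by rw [← ht, h0, zero_div]
    exact_mod_cast h
  obtain ⟨-, -, -, hsha⟩ := shaAn_eq_of_L_one_div_eq hGZK W hL1 ht
  have hvq := padicValRat_shaAn_eq_sub_tamagawa hGZK hnf hMz hX hp5 hsha ht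
  refine hX.missingUpperBoundAt_of_noPTorsion hGZK hsha ?_ hSha
  rw [hvq]
  -- the newform and the set of split primes
  obtain ⟨f, hf⟩ := hnf W
  have hCmem : ∀ ℓ ∈ splitPrimes W, ∃ _ : Fact ℓ.Prime, W.HasSplitMultiplicativeReductionAtPrime ℓ :=
    fun ℓ hℓ => (Finset.mem_filter.mp hℓ).2
  -- (W): `Σ_C v_p η ≤ ord_p t`
  have hWv := hW W p hX hns hp5 f hf (splitPrimes W) hCmem t ht
  -- (T): `v_p ∏c = Σ_C v_p(v_ℓ Δ)`
  have hTv := hT W p hp5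
  -- pointwise (D♭)/(D♯): `v_p(v_ℓ Δ) ≤ v_p η_f(I_ℓ)` on `C`
  have hpt : ∀ ℓ ∈ splitPrimes W, padicValNat p (padicValInt ℓ W.minimalDiscriminantInt) ≤
      padicValNat p (oldCongruenceModulus (W.conductorNorm ℤ) f ℓ) := by
    intro ℓ hℓ
    obtain ⟨hℓF, hsplit⟩ := hCmem ℓ hℓ
    by_cases h1 : ℓ % p = 1
    · exact hD1 W p hX hns hp5 f hf ℓ hsplit h1
    · have h := hD W p hX hns hp5 f hf ℓ hsplit h1
      by_cases hℓp : ℓ = p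
      · subst hℓp
        have hc1 : padicValNat ℓ (padicValInt ℓ W.minimalDiscriminantInt) ≤ 1 := by
          by_contra h2
          push Not at h2
          exact hflat hsplit ((pow_dvd_pow ℓ h2).trans pow_padicValNat_dvd)
        simpa [lowerableDepth, min_eq_right hc1] using h
      · simpa [lowerableDepth, hℓp] using h
  have hsum := Finset.sum_le_sum hpt
  have hsum' : ((∑ ℓ ∈ splitPrimes W, padicValNat p (padicValInt ℓ W.minimalDiscriminantInt) : ℕ) : ℤ) ≤
      ((∑ ℓ ∈ splitPrimes W, padicValNat p (oldCongruenceModulus (W.conductorNorm ℤ) f ℓ) : ℕ) : ℤ) := by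
    exact_mod_cast hsum
  rw [hTv]
  linarith

/-- **Composition, hypotheses form (real proof): S1 ∧ S2 ∧ S3 ∧ S4 ∧ S5 ∧ S6 ⟹ U5 BY NAME** through the record's turnkey
`GL1Cartan.upperNonSurjFive_of_elevenFacts_of_threeFlatCores`: C_tam ← the engine (non-split `p`); C_exc♭ ← the engine on
«`Ш[p] = 0` ∧ `p² ∤ c_p`», else the residual (b); C_exp ← the residual (a). [cite: Miller2011LMS, Def. 1.1] [cite: Kato2004Asterisque, §17.13] -/
theorem UpperNonSurjFive_of_hyps (hP : PrintFacts) (hW : ValueInOldProduct) (hD : MazurPrincipleDepth)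
    (hD1 : CongruentOneDepth) (hT : TamagawaValuationSplits) (hR : Residual) :
    Theses.PrintX11a.UpperNonSurjFive := by
  obtain ⟨hJs, hJn, h12, hnf, hns', hsp', hfine', hMz, hGZK, hCE, hGV, hI, hLL⟩ := hP
  obtain ⟨hRx, hRe⟩ := hR
  refine upperNonSurjFive_of_elevenFacts_of_threeFlatCores hJs hJn h12 hnf hns' hsp' hfine' hMz hGZK hCE hGV hI hLL
    ?_ hRx ?_
  · -- C_exc♭ : split `p`, `Ш[p] ≠ 0` ∨ `2 ≤ ord_p ∏c`
    intro W _ _ p _ hX hns hp5 hsp hor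
    by_cases hSha : ∀ x : W.sha, (p : ℤ) • x = 0 → x = 0
    · by_cases hdeep : p ^ 2 ∣ padicValInt p W.minimalDiscriminantInt
      · exact hRe W p hX hns hp5 hsp (Or.inr hdeep)
      · exact missingUpperBoundAt_of_depth hnf hMz hGZK hW hD hD1 hT hX hns hp5 hSha (fun _ => hdeep)
    · push Not at hSha
      exact hRe W p hX hns hp5 hsp (Or.inl hSha)
  · -- C_tam : non-split `p`, `2 ≤ ord_p ∏c`, `Ш[p] = 0`
    intro W _ _ p _ hX hns hp5 hnsp _ hSha _
    exact missingUpperBoundAt_of_depth hnf hMz hGZK hW hD hD1 hT hX hns hp5 hSha (fun hsp => absurd hsp hnsp)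

/-- **Composition U5 — the crux BY NAME, stub-fed (real proof; `sorry` only inside the six stubs).** [cite: Miller2011LMS, Def. 1.1] -/
theorem UpperNonSurjFive_of_oldprod : Theses.PrintX11a.UpperNonSurjFive :=
  UpperNonSurjFive_of_hyps stub_printFacts stub_valueInOldProduct stub_mazurPrincipleDepth stub_congruentOneDepth
    stub_tamagawaValuationSplits stub_residual

end Summit.BirchSwinnertonDyer.BirchSwinnertonDyer.Cruxes.UpperNonSurjFive.OldProd

end
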